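import Summits.QuantumFields.YangMills.Theorems.BalabanUVNodesN16KingModelNE3Shape
import Summits.QuantumFields.YangMills.Theorems.BalabanUVNodesN18KingModelDensTorus

/-!
# Route «BalabanUVNodes» (K3⁶ `SpineGivenEndpointR13SepCoPR`), DAG node N16 = NE3 — THE KING-MODEL `NE3Shape` WITH KING's UNIFORMITY:
# constants INDEPENDENT OF THE VOLUME — the action half on EVERY unit torus (Plancherel form of Lemma 4.3, n18-b), the local half on BAŁABAN's
# volumes `M_μ = 2Lᵐ` (Prop. 3.8 «combined with Theorem 3.3», n18-b's `king_prop38_torus_blocks`): ONE constant for ALL levels AND ALL volumes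

Cell `pub-ymgap`, seat `pub-ymgap-dag-n16-c` (R134 acceleration seat, strategy s1 «R2^ϱ, the unprinted core»; HUMAN RULING D-0062; chair R424 venue),
generation 9, file 2.  `--supports stmt-QuantumFields-20509 --as helper` (K3⁶).  `bears_on: R4∕N16`.

WHY (a located weakness of this seat's own file 1 and its repair).  `BalabanUVNodesN16KingModelNE3Shape.ne3Shape_kingMin` typed the node's abstract decl
`T4EtaRateMin.NE3Shape` for King's minimiser readings `kingMinReadings L M a m² S` with constant `C₅|Ω|S + θ̄a|Ω|S²`: the ACTION constant there was obtained
through `(Σ_z|φ(z)|)² ≤ |Ω|²S²` and so carries a spurious factor `|Ω|` (the reading's `vol = |Ω|` already accounts for extensivity, as NE3's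
`|A_{k+1}(V) − A_k(V)| ≤ C·θᵏ·vol` does); the LOCAL constant carries `|Ω|` through `Σ_b|φ(b)| ≤ |Ω|S`.  King prints BOTH uniformly in the volume
(p. 664 (3.71): «C» independent of the torus; p. 669 (3.91)–(3.92)).  The tree has what is needed, BY NAME:
* n18-b's PLANCHEREL form of Lemma 4.3 ∕ Prop. 3.10, `YMDAG.N18.KingModelDensTorus.abs_action_sub_le_torus_of_eq`:
  `|½⟨φ, Δ^{(k)}φ⟩ − ½⟨φ, Δ^{(k+n)}φ⟩| ≤ θ_k·a·⟨φ, φ⟩∕2` on EVERY unit torus — with `⟨φ, φ⟩ ≤ |Ω|S²` the action constant becomes `θ̄·a·S²`, VOLUME-FREE;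
* n18-b's `King1986.Torus.king_prop38_torus_blocks` (Prop. 3.8 line 1 «combined with Theorem 3.3»: the two-run kernel difference with King's DECAY
  `e^{−(δ₀∕2)·dist}` on the volumes `M_μ = 2Lᵐ` of the `B1∕B4` tower, `δ₀, c₀` from `d, L, a, m²` only) and the uniform lattice sums
  `King1986/UniformDecay.tdistT_sumBound` — summing the decay instead of counting sites makes the local constant `√(2ac₀C₅)·K_d(δ₀∕2)·S`, VOLUME-FREE
  (the route of g7's ★★ `twoRun_minimiser_blockMean_le_sup`, here at the CORNER point of file 1's reading instead of the block mean).

WHAT THIS FILE PROVES (kernel; 0 `def`, 0 sorry; theorems only, all inputs CITED tree theorems):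
* §1 `dotProduct_self_le_of_abs_le` (`⟨φ,φ⟩ ≤ |Ω|·S²`); ★ `abs_minEnergy_step_le_l2` — `|⟨φ, Δ^{(k+1)}φ⟩ − ⟨φ, Δ^{(k)}φ⟩| ≤ θ̄(a,L)·a·L^{−2k}·⟨φ, φ⟩` (every
  volume; n18-b's Plancherel bound at `N₂ = L^{k+1} = L¹Lᵏ`, `k₂ = k + 1`, + `thetaK_le`); ★ `actionRate_kingMin_unif` —
  `ActionRate (kingMinReadings L M a m² S) (θ̄·a·S²) (L^{−γ})` for `γ ≤ 2` on EVERY volume: the action constant FREE OF `|Ω|`.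
* §2 ★ `localRate_kingMin_blocks` — `∃ C₀ ≥ 0` (a function of `d, L, a, m², γ` ONLY) such that for EVERY volume exponent `m`, `M_μ = 2Lᵐ`, and every `S`:
  `LocalRate (kingMinReadings L M a m² S) (C₀·S) (L^{−γ∕2})` (`0 ≤ γ ≤ 1`; `C₀ = √(2ac₀C₅)·K_d(δ₀∕2)`).
* §3 ★★ **`ne3Shape_kingMin_blocks`** — `∃ C₀ ≥ 0` from `d, L, a, m², γ` only: for every `m`, `M_μ = 2Lᵐ`, `S`:
  `NE3Shape (kingMinReadings L M a m² S) (C₀·S + θ̄·a·S²) (L^{−γ∕2})` (`0 < γ ≤ 1`) — THE NODE's DECL IN KING's MODEL WITH ONE CONSTANT FOR ALL LEVELS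
  AND ALL VOLUMES (King's printed uniformity); `ne3Shape_kingMin_sharp` — on EVERY volume `NE3Shape … (C₅|Ω|S + θ̄aS²) (L^{−γ})` (file 1's ★★ with the
  action constant repaired; the local `|Ω|` is intrinsic there without decay).

HONEST FRAMING.  MODEL LAYER ([King1986] printed AND proved; re-proved in kernel BY NAME from n18-b's files and this seat's file 1).  NOTHING of
[Balaban1985RegularSpaces] ∕ [Balaban1985Variational] is proved; N16 ∕ NE3 NOT discharged (in-edges N05 ∕ N07 remain hypotheses of the chain of record);
COUNT UNMOVED; count-neutral; one finite torus — NOT ℝ⁴ ∕ infinite volume ∕ OS ∕ mass gap ∕ Clay.  Locators [King1986] = C. King, CMP **102** (1986)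
649–677: Thm 3.3 p. 655 ((3.6)–(3.7) p. 656), Prop. 3.8 (3.71) p. 664, Prop. 3.10 (3.91)–(3.92) p. 669, Lemma 4.3 (4.18) p. 672, (4.35) p. 674;
[Balaban1983RegularityDecay] Thm (1.10) p. 573 (the source of Thm 3.3, n18-b's `B4Thm110ZeroTorus` transport).
-/

set_option autoImplicit false

noncomputable section

open Real Finset
open scoped BigOperators Matrix

namespace Summit.QuantumFields.YangMills.BalabanUVNodes.N16KingModelNE3ShapeUniform

open Literature.MathematicalPhysics.QuantumFieldTheory.Balaban1983to89 (Params)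
open Literature.MathematicalPhysics.QuantumFieldTheory.Balaban1983to89.B5Prop11Plancherel (Tor fine)
open Literature.MathematicalPhysics.QuantumFieldTheory.Balaban1983to89.B4Sect5Proof (latticeConst latticeConst_nonneg)
open Literature.MathematicalPhysics.QuantumFieldTheory.Balaban1983to89.T4EtaRateMin (Readings ActionRate LocalRate NE3Shape)
open Literature.MathematicalPhysics.QuantumFieldTheory.King1986 (aK lemma43Const prop38RateConst prop38PosConst thetaK)
open Literature.MathematicalPhysics.QuantumFieldTheory.King1986.Torus
  (minimiser effLaplacian thetaBar thetaK_le aminL_pos blockOf tdistT tdistT_sumBound king_prop38_torus_blocks)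
open Summit.QuantumFields.YangMills.BalabanUVNodes.N18KingModel
  (prop38Const_le_unif prop38Const_unif_nonneg rpow_neg_natPow kingTheta_pos kingTheta_lt_one kingTheta_eq_sq sqrt_mul_sq_mul)
open Summit.QuantumFields.YangMills.BalabanUVNodes.N16KingModel (minimiser_apply_eq_sum)
open Summit.QuantumFields.YangMills.BalabanUVNodes.N16KingModelNE3Shape
  (cornerFine cornerFine_over minimiser_cornerFine_congrN cornerMin_level_congr minEnergy_level_congr inv_sq_pow_le_rate_pow
    kingMinReadings mem_kingMinReadings_dom kingMinReadings_loc kingMinReadings_act kingMinReadings_vol sum_abs_le_of_mem_dom localRate_kingMin)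
open YMDAG.N18.KingModelDensTorus (abs_action_sub_le_torus_of_eq)

variable {d : ℕ}

/-! ## §1 The action half with a VOLUME-FREE constant on every unit torus (n18-b's Plancherel form of Lemma 4.3) -/

/-- `⟨φ, φ⟩ ≤ |Ω|·S²` when `|φ| ≤ S` pointwise. [folklore] -/
theorem dotProduct_self_le_of_abs_le {ι : Type*} [Fintype ι] {φ : ι → ℝ} {S : ℝ} (h : ∀ b, |φ b| ≤ S) :
    φ ⬝ᵥ φ ≤ (Fintype.card ι : ℝ) * S ^ 2 := by
  calc φ ⬝ᵥ φ = ∑ b, φ b * φ b := rfl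
    _ ≤ ∑ _b : ι, S ^ 2 := sum_le_sum fun b _ => by
        have hb : |φ b| * |φ b| ≤ S * S := mul_self_le_mul_self (abs_nonneg _) (h b)
        rw [abs_mul_abs_self] at hb
        rw [sq]
        exact hb
    _ = (Fintype.card ι : ℝ) * S ^ 2 := by rw [sum_const, nsmul_eq_mul, Finset.card_univ]

section Action

variable {L : ℕ} [NeZero L] (M : Fin d → ℕ) [∀ μ, NeZero (M μ)]

/-- ★ **THE ENERGY STEP IN PLANCHEREL FORM** (every volume, `L ≥ 2`, `a, m² > 0`, `k ≥ 1`):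
`|⟨φ, Δ^{(k+1)}φ⟩ − ⟨φ, Δ^{(k)}φ⟩| ≤ θ̄(a, L)·a·L^{−2k}·⟨φ, φ⟩` — n18-b's `abs_action_sub_le_torus_of_eq` (Prop. 3.10 per momentum + Parseval) at the
presentation `N₂ = L^{k+1} = L¹·Lᵏ`, `k₂ = k + 1`, doubled, with `thetaK_le` (`θ_k ≤ θ̄·L^{−2k}`). [cite: King1986, Prop. 3.10 (3.91)–(3.92) p.669, Lemma 4.3 (4.18) p.672, (4.35) p.674] -/
theorem abs_minEnergy_step_le_l2 (hL : 2 ≤ L) {a m2 : ℝ} (ha : 0 < a) (hm : 0 < m2) {k : ℕ} (hk : 1 ≤ k) (φ : Tor M → ℝ) :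
    |φ ⬝ᵥ (effLaplacian (L ^ (k + 1)) M (aK a L (k + 1)) (((L ^ (k + 1) : ℕ) : ℝ) ^ 2) m2 *ᵥ φ)
        - φ ⬝ᵥ (effLaplacian (L ^ k) M (aK a L k) (((L ^ k : ℕ) : ℝ) ^ 2) m2 *ᵥ φ)|
      ≤ thetaBar a L * a * (((L : ℝ) ^ k) ^ 2)⁻¹ * (φ ⬝ᵥ φ) := by
  have h := abs_action_sub_le_torus_of_eq M ha hL hk (le_refl 1) hm (L ^ (k + 1)) (by ring) (k + 1) rfl φ
  have hθ := thetaK_le ha hL hk (le_refl 1) (a := a) (L := L) (k := k) (n := 1)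
  have hφ : 0 ≤ φ ⬝ᵥ φ := Finset.sum_nonneg fun i _ => mul_self_nonneg _
  set A := φ ⬝ᵥ (effLaplacian (L ^ k) M (aK a L k) (((L ^ k : ℕ) : ℝ) ^ 2) m2 *ᵥ φ) with hA
  set B := φ ⬝ᵥ (effLaplacian (L ^ (k + 1)) M (aK a L (k + 1)) (((L ^ (k + 1) : ℕ) : ℝ) ^ 2) m2 *ᵥ φ) with hB
  have h2 : |B - A| = 2 * |A / 2 - B / 2| := by
    rw [show A / 2 - B / 2 = (A - B) / 2 by ring, abs_div, abs_two, abs_sub_comm A B]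
    ring
  calc |B - A| = 2 * |A / 2 - B / 2| := h2
    _ ≤ 2 * (thetaK a L k 1 * a * (φ ⬝ᵥ φ) / 2) := mul_le_mul_of_nonneg_left h two_pos.le
    _ = thetaK a L k 1 * a * (φ ⬝ᵥ φ) := by ring
    _ ≤ thetaBar a L * (((L : ℝ) ^ k) ^ 2)⁻¹ * a * (φ ⬝ᵥ φ) :=
        mul_le_mul_of_nonneg_right (mul_le_mul_of_nonneg_right hθ ha.le) hφ
    _ = thetaBar a L * a * (((L : ℝ) ^ k) ^ 2)⁻¹ * (φ ⬝ᵥ φ) := by ring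

/-- ★ **THE ACTION HALF WITH A VOLUME-FREE CONSTANT, EVERY VOLUME**: `ActionRate (kingMinReadings L M a m² S) (θ̄·a·S²) (L^{−γ})` for `L ≥ 2`,
`a, m² > 0`, `γ ≤ 2`, every unit torus `M` and size `S` — `|⟨φ,Δ^{(k+1)}φ⟩ − ⟨φ,Δ^{(k)}φ⟩| ≤ (θ̄aS²)·(L^{−γ})ᵏ·|Ω|`: the constant reads `a, L, S` only; the
volume sits in the reading's `vol = |Ω|` (extensivity), exactly as in NE3's `C·θᵏ·vol`. [cite: King1986, Prop. 3.10 (3.91)–(3.92) p.669, Lemma 4.3 (4.18) p.672] -/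
theorem actionRate_kingMin_unif (hL : 2 ≤ L) {a m2 : ℝ} (ha : 0 < a) (hm : 0 < m2) {γ : ℝ} (hγ2 : γ ≤ 2) (S : ℝ) :
    ActionRate (kingMinReadings L M a m2 S) (thetaBar a L * a * S ^ 2) ((L : ℝ) ^ (-γ)) := by
  have hθbar : 0 ≤ thetaBar a L := by
    have := (inv_pos.2 (aminL_pos ha hL)).le
    unfold thetaBar
    positivity
  have hθ0 : 0 ≤ (L : ℝ) ^ (-γ) := (kingTheta_pos (by omega) γ).le
  intro k φ hφ
  have hφS : ∀ b, |φ b| ≤ S := (mem_kingMinReadings_dom L M a m2 S φ).1 hφ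
  rw [kingMinReadings_act, kingMinReadings_act, kingMinReadings_vol]
  rcases Nat.eq_zero_or_pos k with rfl | hk
  · rw [minEnergy_level_congr (show max (0 + 1) 1 = max 0 1 by rfl) M a m2 φ, sub_self, abs_zero]
    positivity
  · have hk1 : 1 ≤ k := hk
    rw [minEnergy_level_congr (show max (k + 1) 1 = k + 1 from max_eq_left (by omega)) M a m2 φ,
      minEnergy_level_congr (show max k 1 = k from max_eq_left hk1) M a m2 φ]
    have hdot : φ ⬝ᵥ φ ≤ (Fintype.card (Tor M) : ℝ) * S ^ 2 := dotProduct_self_le_of_abs_le hφS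
    calc |φ ⬝ᵥ (effLaplacian (L ^ (k + 1)) M (aK a L (k + 1)) (((L ^ (k + 1) : ℕ) : ℝ) ^ 2) m2 *ᵥ φ)
            - φ ⬝ᵥ (effLaplacian (L ^ k) M (aK a L k) (((L ^ k : ℕ) : ℝ) ^ 2) m2 *ᵥ φ)|
          ≤ thetaBar a L * a * (((L : ℝ) ^ k) ^ 2)⁻¹ * (φ ⬝ᵥ φ) := abs_minEnergy_step_le_l2 M hL ha hm hk1 φ
      _ ≤ thetaBar a L * a * ((L : ℝ) ^ (-γ)) ^ k * ((Fintype.card (Tor M) : ℝ) * S ^ 2) :=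
          mul_le_mul (mul_le_mul_of_nonneg_left (inv_sq_pow_le_rate_pow (by omega) hγ2 k) (mul_nonneg hθbar ha.le)) hdot
            (Finset.sum_nonneg fun i _ => mul_self_nonneg _) (mul_nonneg (mul_nonneg hθbar ha.le) (pow_nonneg hθ0 k))
      _ = thetaBar a L * a * S ^ 2 * ((L : ℝ) ^ (-γ)) ^ k * (Fintype.card (Tor M) : ℝ) := by ring

/-- ★★ (every volume, sharp action constant) **`NE3Shape (kingMinReadings L M a m² S) (C₅·|Ω|·S + θ̄·a·S²) (L^{−γ})`** for `d ≥ 1`, odd `L ≥ 2`, `a, m² > 0`,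
`0 < γ ≤ 1`, every unit torus `M`, every `S` — file 1's ★★ `ne3Shape_kingMin` with the action constant repaired (`actionRate_kingMin_unif`); the local
`|Ω|` is intrinsic on an arbitrary volume (no decay input there). [cite: King1986, Prop. 3.8 (3.71) p.664, Prop. 3.10 (3.91)–(3.92) p.669] -/
theorem ne3Shape_kingMin_sharp (hd : 0 < d) (hLodd : Odd L) (hL : 2 ≤ L) {a m2 : ℝ} (ha : 0 < a) (hm : 0 < m2) {γ : ℝ}
    (hγ0 : 0 < γ) (hγ1 : γ ≤ 1) (S : ℝ) :
    NE3Shape (kingMinReadings L M a m2 S)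
      ((prop38RateConst a a (a * (2 * ((a * (1 - ((L : ℝ) ^ 2)⁻¹))⁻¹ + π ^ 2 / 48 + 1 / 3))) ((π ^ 2 / 4) ^ d) d γ
          + prop38PosConst a ((π ^ 2 / 4) ^ d) d γ) * (Fintype.card (Tor M) : ℝ) * S
        + thetaBar a L * a * S ^ 2)
      ((L : ℝ) ^ (-γ)) := by
  set Cu : ℝ := prop38RateConst a a (a * (2 * ((a * (1 - ((L : ℝ) ^ 2)⁻¹))⁻¹ + π ^ 2 / 48 + 1 / 3))) ((π ^ 2 / 4) ^ d) d γ
    + prop38PosConst a ((π ^ 2 / 4) ^ d) d γ with hCu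
  have hCu0 : 0 ≤ Cu := prop38Const_unif_nonneg hd ha hL (by linarith)
  have hθbar : 0 ≤ thetaBar a L := by
    have := (inv_pos.2 (aminL_pos ha hL)).le
    unfold thetaBar
    positivity
  have hθ0 : 0 ≤ (L : ℝ) ^ (-γ) := (kingTheta_pos (by omega) γ).le
  have hloc := localRate_kingMin M hd hLodd hL ha hm hγ0.le hγ1 S
  have hact := actionRate_kingMin_unif M hL ha hm (show γ ≤ 2 by linarith) S
  refine ⟨hθ0, kingTheta_lt_one hL hγ0, ?_, ?_⟩
  · intro k φ hφ
    obtain ⟨-, hS0⟩ := sum_abs_le_of_mem_dom M hφ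
    refine (hact k φ hφ).trans ?_
    rw [kingMinReadings_vol]
    have h1 : 0 ≤ Cu * (Fintype.card (Tor M) : ℝ) * S := by positivity
    have h2 : 0 ≤ ((L : ℝ) ^ (-γ)) ^ k * (Fintype.card (Tor M) : ℝ) := by positivity
    nlinarith
  · intro k φ hφ y
    obtain ⟨-, hS0⟩ := sum_abs_le_of_mem_dom M hφ
    refine (hloc k φ hφ y).trans ?_
    have h1 : 0 ≤ thetaBar a L * a * S ^ 2 := by positivity
    have h2 : 0 ≤ ((L : ℝ) ^ (-γ)) ^ k := by positivity
    nlinarith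

end Action

/-! ## §2 The local half with a VOLUME-FREE constant on Bałaban's volumes (Prop. 3.8 «combined with Theorem 3.3», summed over the decay) -/

section Blocks

variable {L : ℕ} [NeZero L]

/-- ★ **THE LOCAL HALF WITH ONE CONSTANT FOR ALL LEVELS AND ALL VOLUMES** (`d ≥ 1`, odd `L ≥ 2`, `a, m² > 0`, `0 ≤ γ ≤ 1`): there is `C₀ ≥ 0`, a function of
`d, L, a, m², γ` ONLY (`C₀ = √(2ac₀C₅)·K_d(δ₀∕2)` with n18-b's `δ₀, c₀` and n18-a's uniform `C₅`), such that on EVERY volume `M_μ = 2Lᵐ` of the `B1∕B4` tower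
and for every data size `S`: `LocalRate (kingMinReadings L M a m² S) (C₀·S) (L^{−γ∕2})` — at each unit site the corner pair of levels `k`, `k+1` is fed to
`king_prop38_torus_blocks` (`P = (d, L, m, k)`, `n = 1`; decay `e^{−(δ₀∕2)·dist(y, b)}`), the datum is expanded (`minimiser_apply_eq_sum`) and the decay summed
by `tdistT_sumBound` instead of counting sites. [cite: King1986, Prop. 3.8 (3.71) p.664, Thm 3.3 p.655, p.674; Balaban1983RegularityDecay, Thm (1.10) p.573] -/
theorem localRate_kingMin_blocks (hd : 1 ≤ d) (hLodd : Odd L) (hL : 2 ≤ L) {a m2 : ℝ} (ha : 0 < a) (hm : 0 < m2)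
    {γ : ℝ} (hγ0 : 0 ≤ γ) (hγ1 : γ ≤ 1) :
    ∃ C₀ : ℝ, 0 ≤ C₀ ∧ ∀ (m : ℕ) (M : Fin d → ℕ) [∀ μ, NeZero (M μ)] (_hM : ∀ μ, M μ = 2 * L ^ m) (S : ℝ),
      LocalRate (kingMinReadings L M a m2 S) (C₀ * S) ((L : ℝ) ^ (-(γ / 2))) := by
  obtain ⟨δ₀, c₀, hδ₀, hc₀, H⟩ := king_prop38_torus_blocks d L hd hLodd hL ha hm hγ0 hγ1
  have hd0 : 0 < d := by omega
  have hL1 : 1 < L := by omega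
  set Cu : ℝ := prop38RateConst a a (a * (2 * ((a * (1 - ((L : ℝ) ^ 2)⁻¹))⁻¹ + π ^ 2 / 48 + 1 / 3))) ((π ^ 2 / 4) ^ d) d γ
    + prop38PosConst a ((π ^ 2 / 4) ^ d) d γ with hCu
  have hCu0 : 0 ≤ Cu := prop38Const_unif_nonneg hd0 ha hL (by linarith)
  set s : ℝ := (L : ℝ) ^ (-(γ / 2)) with hs_def
  have hs : 0 ≤ s := Real.rpow_nonneg (Nat.cast_nonneg _) _
  refine ⟨Real.sqrt (2 * (a * c₀) * Cu) * latticeConst d (δ₀ / 2),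
    mul_nonneg (Real.sqrt_nonneg _) (latticeConst_nonneg d (by positivity)), ?_⟩
  intro m M _ hM S k φ hφ y
  obtain ⟨-, hS0⟩ := sum_abs_le_of_mem_dom M hφ
  have hφS : ∀ b, |φ b| ≤ S := (mem_kingMinReadings_dom L M a m2 S φ).1 hφ
  have hK0 : 0 ≤ latticeConst d (δ₀ / 2) := latticeConst_nonneg d (by positivity)
  rw [kingMinReadings_loc, kingMinReadings_loc]
  rcases Nat.eq_zero_or_pos k with rfl | hk
  · rw [cornerMin_level_congr (show max (0 + 1) 1 = max 0 1 by rfl) M a m2 φ y, sub_self, abs_zero]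
    positivity
  · have hk1 : 1 ≤ k := hk
    rw [cornerMin_level_congr (show max (k + 1) 1 = k + 1 from max_eq_left (by omega)) M a m2 φ y,
      cornerMin_level_congr (show max k 1 = k from max_eq_left hk1) M a m2 φ y]
    have hN : L ^ 1 * L ^ k = L ^ (k + 1) := by ring
    rw [← minimiser_cornerFine_congrN hN M (aK a L (k + 1)) m2 φ y]
    -- the tower volume `P = (d, L, m, k)`: its unit torus has `P.sitesPerDir P.K = 2Lᵐ` sites per direction
    haveI : NeZero ((⟨d, L, m, k, hd, ⟨hLodd, hL1⟩⟩ : Params).L) := ‹NeZero L›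
    have hMK : ∀ μ, M μ = (⟨d, L, m, k, hd, ⟨hLodd, hL1⟩⟩ : Params).sitesPerDir k := by
      intro μ
      rw [hM μ]
      simp [Params.sitesPerDir]
    set Ck : ℝ := prop38RateConst a a (lemma43Const a L k 1) ((π ^ 2 / 4) ^ d) d γ
      + prop38PosConst a ((π ^ 2 / 4) ^ d) d γ with hCk
    have hCle : Ck ≤ Cu := prop38Const_le_unif hd0 ha hL hk1 (le_refl 1) (by linarith)
    set x₀ : Tor M := blockOf (L ^ k) M (cornerFine (L ^ k) M y) with hx₀
    -- the per-kernel bound at the corner pair with King's decay, rate rewritten as `(L^{−γ/2})^k`, constant majorised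
    have hker : ∀ b : Tor M,
        |minimiser (L ^ 1 * L ^ k) M (aK a L (k + 1)) (((L ^ 1 * L ^ k : ℕ) : ℝ) ^ 2) m2 (Pi.single b 1) (cornerFine (L ^ 1 * L ^ k) M y)
            - minimiser (L ^ k) M (aK a L k) (((L ^ k : ℕ) : ℝ) ^ 2) m2 (Pi.single b 1) (cornerFine (L ^ k) M y)|
          ≤ Real.sqrt (2 * (a * c₀) * Cu) * s ^ k * Real.exp (-(δ₀ / 2 * tdistT M x₀ b)) := by
      intro b
      have h : |minimiser (L ^ 1 * L ^ k) M (aK a L (k + 1)) (((L ^ 1 * L ^ k : ℕ) : ℝ) ^ 2) m2 (Pi.single b 1)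
              (cornerFine (L ^ 1 * L ^ k) M y)
            - minimiser (L ^ k) M (aK a L k) (((L ^ k : ℕ) : ℝ) ^ 2) m2 (Pi.single b 1) (cornerFine (L ^ k) M y)|
          ≤ Real.sqrt ((Ck * ((L ^ k : ℕ) : ℝ) ^ (-γ)) * (2 * (a * c₀))) * Real.exp (-(δ₀ / 2 * tdistT M x₀ b)) :=
        H ⟨d, L, m, k, hd, ⟨hLodd, hL1⟩⟩ rfl rfl hk1 1 (le_refl 1) M hMK (cornerFine (L ^ k) M y)
          (cornerFine (L ^ 1 * L ^ k) M y) b (cornerFine_over k 1 M y)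
      refine h.trans ?_
      have hrate : ((L ^ k : ℕ) : ℝ) ^ (-γ) = (s ^ k) ^ 2 := by
        rw [rpow_neg_natPow, kingTheta_eq_sq, ← pow_mul, ← pow_mul, mul_comm]
      have hsq : Real.sqrt (Ck * ((L ^ k : ℕ) : ℝ) ^ (-γ) * (2 * (a * c₀))) = Real.sqrt (Ck * (2 * (a * c₀))) * s ^ k := by
        rw [hrate, sqrt_mul_sq_mul (pow_nonneg hs _)]
      have hmono : Real.sqrt (Ck * (2 * (a * c₀))) ≤ Real.sqrt (2 * (a * c₀) * Cu) := by
        rw [mul_comm Ck]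
        exact Real.sqrt_le_sqrt (mul_le_mul_of_nonneg_left hCle (by positivity))
      rw [hsq]
      gcongr
    -- expand both runs in the datum and sum the decay over the unit torus
    have hsum : ∑ b : Tor M, Real.exp (-(δ₀ / 2 * tdistT M x₀ b)) ≤ latticeConst d (δ₀ / 2) :=
      tdistT_sumBound M (δ₀ / 2) (by positivity) x₀
    have hR0 : 0 ≤ Real.sqrt (2 * (a * c₀) * Cu) * s ^ k := mul_nonneg (Real.sqrt_nonneg _) (pow_nonneg hs _)
    rw [minimiser_apply_eq_sum (L ^ 1 * L ^ k) M (aK a L (k + 1)) (((L ^ 1 * L ^ k : ℕ) : ℝ) ^ 2) m2 φ,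
      minimiser_apply_eq_sum (L ^ k) M (aK a L k) (((L ^ k : ℕ) : ℝ) ^ 2) m2 φ, ← Finset.sum_sub_distrib]
    calc |∑ b, (φ b * minimiser (L ^ 1 * L ^ k) M (aK a L (k + 1)) (((L ^ 1 * L ^ k : ℕ) : ℝ) ^ 2) m2 (Pi.single b 1)
              (cornerFine (L ^ 1 * L ^ k) M y)
            - φ b * minimiser (L ^ k) M (aK a L k) (((L ^ k : ℕ) : ℝ) ^ 2) m2 (Pi.single b 1) (cornerFine (L ^ k) M y))|
        ≤ ∑ b, |φ b * minimiser (L ^ 1 * L ^ k) M (aK a L (k + 1)) (((L ^ 1 * L ^ k : ℕ) : ℝ) ^ 2) m2 (Pi.single b 1)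
              (cornerFine (L ^ 1 * L ^ k) M y)
            - φ b * minimiser (L ^ k) M (aK a L k) (((L ^ k : ℕ) : ℝ) ^ 2) m2 (Pi.single b 1) (cornerFine (L ^ k) M y)| :=
          Finset.abs_sum_le_sum_abs _ _
      _ ≤ ∑ b, S * (Real.sqrt (2 * (a * c₀) * Cu) * s ^ k * Real.exp (-(δ₀ / 2 * tdistT M x₀ b))) := by
          refine Finset.sum_le_sum fun b _ => ?_
          rw [← mul_sub, abs_mul]
          exact mul_le_mul (hφS b) (hker b) (abs_nonneg _) hS0
      _ = Real.sqrt (2 * (a * c₀) * Cu) * s ^ k * S * ∑ b, Real.exp (-(δ₀ / 2 * tdistT M x₀ b)) := by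
          rw [← Finset.mul_sum, ← Finset.mul_sum]; ring
      _ ≤ Real.sqrt (2 * (a * c₀) * Cu) * s ^ k * S * latticeConst d (δ₀ / 2) :=
          mul_le_mul_of_nonneg_left hsum (mul_nonneg hR0 hS0)
      _ = Real.sqrt (2 * (a * c₀) * Cu) * latticeConst d (δ₀ / 2) * S * s ^ k := by ring

/-! ## §3 ★★ The node's decl in King's model with ONE constant for all levels and all volumes -/

/-- ★★ **`NE3Shape` IN KING's MODEL WITH KING's UNIFORMITY** (`d ≥ 1`, odd `L ≥ 2`, `a, m² > 0`, `0 < γ ≤ 1`): there is `C₀ ≥ 0`, a function of `d, L, a, m², γ`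
ONLY, such that on EVERY volume `M_μ = 2Lᵐ` of the `B1∕B4` tower and for every data size `S`:
`NE3Shape (kingMinReadings L M a m² S) (C₀·S + θ̄(a,L)·a·S²) (L^{−γ∕2})` — rate `0 < L^{−γ∕2} < 1`, local half `localRate_kingMin_blocks`, action half
`actionRate_kingMin_unif` (its rate `L⁻²` weakened to `L^{−γ∕2}`): the constant reads NEITHER the level NOR the volume — the uniformity King prints for (3.71) and
(3.91)–(3.92), now on the node's own decl. [cite: King1986, Prop. 3.8 (3.71) p.664, Prop. 3.10 (3.91)–(3.92) p.669, Thm 3.3 p.655] -/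
theorem ne3Shape_kingMin_blocks (hd : 1 ≤ d) (hLodd : Odd L) (hL : 2 ≤ L) {a m2 : ℝ} (ha : 0 < a) (hm : 0 < m2)
    {γ : ℝ} (hγ0 : 0 < γ) (hγ1 : γ ≤ 1) :
    ∃ C₀ : ℝ, 0 ≤ C₀ ∧ ∀ (m : ℕ) (M : Fin d → ℕ) [∀ μ, NeZero (M μ)] (_hM : ∀ μ, M μ = 2 * L ^ m) (S : ℝ),
      NE3Shape (kingMinReadings L M a m2 S) (C₀ * S + thetaBar a L * a * S ^ 2) ((L : ℝ) ^ (-(γ / 2))) := by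
  obtain ⟨C₀, hC₀, HL⟩ := localRate_kingMin_blocks hd hLodd hL ha hm hγ0.le hγ1
  have hθbar : 0 ≤ thetaBar a L := by
    have := (inv_pos.2 (aminL_pos ha hL)).le
    unfold thetaBar
    positivity
  have hθ0 : 0 ≤ (L : ℝ) ^ (-(γ / 2)) := (kingTheta_pos (by omega) (γ / 2)).le
  refine ⟨C₀, hC₀, fun m M _ hM S => ?_⟩
  have hloc := HL m M hM S
  have hact := actionRate_kingMin_unif M hL ha hm (show γ / 2 ≤ 2 by linarith) S
  refine ⟨hθ0, kingTheta_lt_one hL (by linarith), ?_, ?_⟩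
  · intro k φ hφ
    obtain ⟨-, hS0⟩ := sum_abs_le_of_mem_dom M hφ
    refine (hact k φ hφ).trans ?_
    rw [kingMinReadings_vol]
    have h1 : 0 ≤ C₀ * S := by positivity
    have h2 : 0 ≤ ((L : ℝ) ^ (-(γ / 2))) ^ k * (Fintype.card (Tor M) : ℝ) := by positivity
    nlinarith
  · intro k φ hφ y
    obtain ⟨-, hS0⟩ := sum_abs_le_of_mem_dom M hφ
    refine (hloc k φ hφ y).trans ?_
    have h1 : 0 ≤ thetaBar a L * a * S ^ 2 := by positivity
    have h2 : 0 ≤ ((L : ℝ) ^ (-(γ / 2))) ^ k := by positivity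
    nlinarith

end Blocks

end Summit.QuantumFields.YangMills.BalabanUVNodes.N16KingModelNE3ShapeUniform

end
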